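import Literature.NumberTheory.DiophantineGeometry.RothLemma
import Literature.NumberTheory.DiophantineApproximation.RidoutIndexTheorem
import Literature.NumberTheory.DiophantineApproximation.RidoutClasses

/-!
# The `p`-adic Roth theorem over `ℚ` (Ridout) — IV. The contradiction for one class

Fourth file towards the `p`-adic Thue–Siegel–Roth theorem for integers over `ℚ` (Ridout 1958
[Ridout1958]; Mahler 1961; Bombieri–Gubler [BombieriGubler2006] Thm. 6.2.3 with 6.2.5–6.2.6), on
top of the tree's proof of Roth's theorem after Schmidt, LNM 785, Ch. V [Schmidt1980]
(`DiophantineGeometry/Roth*`). This file is the analogue of Schmidt's §11 (`RothAssembly.lean`)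
for one of Mahler's approximation classes (B–G §6.4, Steps I–V of 6.2.9 with several places):

`Ridout.false_of_class`: let `S` be a finite set of primes, `θ_p ∈ \overline{ℚ_p}` a root of a
monic `Q_p ∈ ℤ[X]` (`p ∈ S`), `c₀ ≥ 1`, `ε > 0`, and `λ_p ≥ 0` with `(1+ε) Σ_p λ_p ≥ 1 + ε/2`.
Then there is NO unlimited supply (arbitrarily large denominators) of rationals `ρ` with
`|num ρ| ≤ c₀` and `min(1, |ρ − θ_p|_p) ≤ den(ρ)^{-(1+ε)λ_p}` for all `p ∈ S`.

Proof (Schmidt §11 (ii)–(vii) verbatim for the parameters, B–G Steps III–V for the estimates):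
`ε₁ = min(ε,1)/40`; `m = ⌈16ε₁⁻² log 4D⌉ + 2` with `D = 1 + Σ_p deg Q_p`, `ω = ω(m, ε₁) < 1`;
the auxiliary polynomial `P` of the several-targets Index Theorem (`Ridout.indexTheorem`, targets
`θ_p` for `p ∈ S` and `0` for the place `∞`) has index `≥ (m/2)(1−ε₁)` at every `(θ_p,…,θ_p)`
and at the origin, `|P| ≤ B^{Σ r_h}`; a chain `ρ_1,…,ρ_m` from the supply with `q_1` large and
`ω log q_{h+1} ≥ 2 log q_h` and Schmidt's degrees `r_h` ((8.4), (10.3)–(10.6)); Roth's Lemma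
`Roth.rothLemma` gives `J` with `Σ J_h/r_h ≤ ε₁` and `T = P_J(ρ) ≠ 0`. Then (product formula,
`Ridout.one_le_abs_mul_prod_norm`) `1 ≤ |T| Π_h q_h^{r_h} Π_{p∈S} min(1,|T|_p)`, while
`|T| ≤ (4Bc₀)^{m r₁} e^{−w₀W}` (`Ridout.abs_aeval_le_of_indexGe_zero`, `|ρ_h| ≤ c₀/q_h`),
`Π q_h^{r_h} ≤ e^{m(1+ε₁)W}` and `min(1,|T|_p) ≤ e^{−(1+ε)λ_p w₀ W}`
(`Ridout.norm_aeval_le_of_indexGe`), with `W = r₁ log q₁`, `w₀ = (m/2)(1−ε₁) − ε₁`; the exponent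
is `≤ m r₁ (log(4Bc₀) − (13ε/80) log q₁) < 0` for `log q₁ > 8(log(4Bc₀)+1)/ε` — a contradiction.

## References

* [BombieriGubler2006] E. Bombieri, W. Gubler, *Heights in Diophantine Geometry*, CUP 2006,
  6.2.9, §6.4 (Thm. 6.4.1), 6.2.5–6.2.6.
* [Schmidt1980] W. M. Schmidt, *Diophantine Approximation*, LNM 785, Springer 1980, Ch. V §11.
* [Ridout1958] D. Ridout, *The `p`-adic generalization of the Thue–Siegel–Roth theorem*,
  Mathematika 5 (1958) 40–48.
-/

noncomputable section

open MvPolynomial Finset Real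
open scoped Polynomial

namespace Literature.NumberTheory.DiophantineApproximation

namespace Ridout

open Literature.NumberTheory.DiophantineGeometry.Roth

/-- `ω(m, ε) ≤ ε/2` for `m ≥ 2`, `0 ≤ ε ≤ 12` (the tree's `Roth.omega_le_half`, which lives in
`RothAssembly.lean`; restated to keep the imports of this file light).
[cite: Schmidt1980, Ch. V §11] -/
theorem omega_le_half' {m : ℕ} (hm : 2 ≤ m) {ε : ℝ} (hε0 : 0 ≤ ε) (hε : ε ≤ 12) :
    omega m ε ≤ ε / 2 := by
  unfold omega
  have h1 : (24 : ℝ) * 2⁻¹ ^ m ≤ 6 := by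
    have : (2⁻¹ : ℝ) ^ m ≤ 2⁻¹ ^ 2 := pow_le_pow_of_le_one (by norm_num) (by norm_num) hm
    norm_num at this ⊢
    linarith
  have h2 : (ε / 12) ^ 2 ^ (m - 1) ≤ ε / 12 :=
    pow_le_of_le_one (by positivity) (by linarith) (pow_ne_zero _ two_ne_zero)
  calc 24 * 2⁻¹ ^ m * (ε / 12) ^ 2 ^ (m - 1) ≤ 6 * (ε / 12) :=
        mul_le_mul h1 h2 (by positivity) (by norm_num)
    _ = ε / 2 := by ring

/-- **Schmidt's degrees** (Ch. V §11 (vi)–(vii)): for denominators `2 < q₀ < q₁ < ⋯ < q_{m-1}`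
with `ω log q_{h+1} ≥ 2 log q_h`, `0 < ε₁ ≤ 1`, the integers `r₀ = ⌈log q_{m-1}/(ε₁ log q₀)⌉ + 1`,
`r_h = ⌊r₀ log q₀ / log q_h⌋ + 1` satisfy (8.4) `r₀ log q₀ ≤ r_h log q_h ≤ (1+ε₁) r₀ log q₀`,
`r_h ≤ r₀`, (10.3) `r_{h+1} ≤ ω r_h` and (10.4) `q₀^{r₀} ≤ q_h^{r_h}` (extracted verbatim from the
tree's `Roth.false_of_liouvilleWith`). [cite: Schmidt1980, Ch. V §11 (vi)–(vii)] -/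
theorem exists_degrees {m : ℕ} (hm0 : 0 < m) (q : Fin m → ℕ) (hq2 : ∀ h, (2 : ℝ) < q h)
    (hqle : ∀ h h' : Fin m, h ≤ h' → q h ≤ q h') (hqlt : ∀ h h' : Fin m, h < h' → q h < q h')
    {ω : ℝ} (hω0 : 0 < ω)
    (hLgrow : ∀ h h' : Fin m, (h : ℕ) + 1 = h' → (2 / ω) * Real.log (q h) ≤ Real.log (q h'))
    {ε₁ : ℝ} (hε₁0 : 0 < ε₁) (hε₁1 : ε₁ ≤ 1) :
    ∃ r : Fin m → ℕ, (∀ h, 0 < r h) ∧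
      (∀ h, (r ⟨0, hm0⟩ : ℝ) * Real.log (q ⟨0, hm0⟩) ≤ r h * Real.log (q h)) ∧
      (∀ h, (r h : ℝ) * Real.log (q h) ≤ (1 + ε₁) * (r ⟨0, hm0⟩ * Real.log (q ⟨0, hm0⟩))) ∧
      (∀ h, r h ≤ r ⟨0, hm0⟩) ∧
      (∀ h h' : Fin m, (h : ℕ) + 1 = h' → (r h' : ℝ) ≤ ω * r h) ∧
      (∀ h, (q ⟨0, hm0⟩ : ℝ) ^ (r ⟨0, hm0⟩) ≤ (q h : ℝ) ^ (r h)) := by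
  classical
  have hqR0 : ∀ h, (0 : ℝ) < q h := fun h => by linarith [hq2 h]
  have hL0 : ∀ h, 0 < Real.log (q h) := fun h => Real.log_pos (by linarith [hq2 h])
  have hLle : ∀ h h' : Fin m, h ≤ h' → Real.log (q h) ≤ Real.log (q h') := fun h h' hh =>
    Real.log_le_log (hqR0 h) (by exact_mod_cast hqle h h' hh)
  have hLlt : ∀ h h' : Fin m, h < h' → Real.log (q h) < Real.log (q h') := fun h h' hh =>
    Real.log_lt_log (hqR0 h) (by exact_mod_cast hqlt h h' hh)
  set i₀ : Fin m := ⟨0, hm0⟩ with hi₀_def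
  set iₗ : Fin m := ⟨m - 1, by omega⟩ with hiₗ_def
  have hi₀le : ∀ h : Fin m, i₀ ≤ h := fun h => Fin.mk_le_of_le_val (Nat.zero_le _)
  have hleₗ : ∀ h : Fin m, h ≤ iₗ := fun h => by
    rw [Fin.le_def]; have := h.isLt; simp only [hiₗ_def]; omega
  set r₁ : ℕ := ⌈Real.log (q iₗ) / (ε₁ * Real.log (q i₀))⌉₊ + 1 with hr₁_def
  have hr₁pos : 0 < r₁ := Nat.succ_pos _
  have hr₁R : (0 : ℝ) < r₁ := by exact_mod_cast hr₁pos
  have hr₁ge : Real.log (q iₗ) ≤ ε₁ * r₁ * Real.log (q i₀) := by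
    have h1 : Real.log (q iₗ) / (ε₁ * Real.log (q i₀)) ≤ r₁ := by
      rw [hr₁_def]; push_cast
      exact (Nat.le_ceil _).trans (by linarith)
    rw [div_le_iff₀ (mul_pos hε₁0 (hL0 i₀))] at h1
    linarith
  set r : Fin m → ℕ := fun h =>
    if h = i₀ then r₁ else ⌊(r₁ : ℝ) * Real.log (q i₀) / Real.log (q h)⌋₊ + 1 with hr_def
  have hri₀ : r i₀ = r₁ := by simp [hr_def]
  have hr_of_ne : ∀ h, h ≠ i₀ →
      r h = ⌊(r₁ : ℝ) * Real.log (q i₀) / Real.log (q h)⌋₊ + 1 := fun h hh => by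
    simp [hr_def, hh]
  have hr0 : ∀ h, 0 < r h := by
    intro h; by_cases hh : h = i₀
    · rw [hh, hri₀]; exact hr₁pos
    · rw [hr_of_ne h hh]; exact Nat.succ_pos _
  -- (8.4), lower half
  have hR1 : ∀ h, (r i₀ : ℝ) * Real.log (q i₀) ≤ r h * Real.log (q h) := by
    intro h; by_cases hh : h = i₀
    · rw [hh]
    · rw [hri₀, hr_of_ne h hh]
      have hx : (r₁ : ℝ) * Real.log (q i₀) / Real.log (q h) <
          (⌊(r₁ : ℝ) * Real.log (q i₀) / Real.log (q h)⌋₊ : ℝ) + 1 := Nat.lt_floor_add_one _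
      rw [div_lt_iff₀ (hL0 h)] at hx
      push_cast
      linarith
  -- (8.4), upper half
  have hR2 : ∀ h, (r h : ℝ) * Real.log (q h) ≤ (1 + ε₁) * (r i₀ * Real.log (q i₀)) := by
    intro h; by_cases hh : h = i₀
    · rw [hh, hri₀]
      have := mul_nonneg hε₁0.le (mul_pos hr₁R (hL0 i₀)).le
      linarith
    · rw [hri₀, hr_of_ne h hh]
      have hx : (⌊(r₁ : ℝ) * Real.log (q i₀) / Real.log (q h)⌋₊ : ℝ) ≤
          (r₁ : ℝ) * Real.log (q i₀) / Real.log (q h) := Nat.floor_le (by positivity)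
      have h1 := mul_le_mul_of_nonneg_right hx (hL0 h).le
      rw [div_mul_cancel₀ _ (hL0 h).ne'] at h1
      have h2 : Real.log (q h) ≤ Real.log (q iₗ) := hLle h iₗ (hleₗ h)
      push_cast
      linarith [hr₁ge]
  -- `r_h ≤ r₁`
  have hR3 : ∀ h, r h ≤ r₁ := by
    intro h; by_cases hh : h = i₀
    · rw [hh, hri₀]
    · rw [hr_of_ne h hh]
      have hlt : i₀ < h := lt_of_le_of_ne (hi₀le h) (Ne.symm hh)
      have hx : (r₁ : ℝ) * Real.log (q i₀) / Real.log (q h) < r₁ := by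
        rw [div_lt_iff₀ (hL0 h)]
        exact mul_lt_mul_of_pos_left (hLlt i₀ h hlt) hr₁R
      have : ⌊(r₁ : ℝ) * Real.log (q i₀) / Real.log (q h)⌋₊ < r₁ :=
        (Nat.floor_lt (by positivity)).mpr hx
      omega
  -- (10.3)
  have hR4 : ∀ h h' : Fin m, (h : ℕ) + 1 = h' → (r h' : ℝ) ≤ ω * r h := by
    intro h h' hh
    have h1 : (r h' : ℝ) * Real.log (q h') ≤ (1 + ε₁) * (r h * Real.log (q h)) :=
      (hR2 h').trans (mul_le_mul_of_nonneg_left (hR1 h) (by linarith))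
    have h2 := hLgrow h h' hh
    have h3 : ((r h' : ℝ) * (2 / ω)) * Real.log (q h) ≤ ((1 + ε₁) * r h) * Real.log (q h) := by
      have := mul_le_mul_of_nonneg_left h2 (Nat.cast_nonneg (r h'))
      linarith
    have h4 : (r h' : ℝ) * (2 / ω) ≤ (1 + ε₁) * r h := le_of_mul_le_mul_right h3 (hL0 h)
    rw [← mul_div_assoc, div_le_iff₀ hω0] at h4
    have h5 : 0 ≤ (1 - ε₁) * ω * r h :=
      mul_nonneg (mul_nonneg (sub_nonneg.mpr hε₁1) hω0.le) (Nat.cast_nonneg _)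
    linarith
  -- (10.4)
  have hR5 : ∀ h, (q i₀ : ℝ) ^ (r i₀) ≤ (q h : ℝ) ^ (r h) := by
    intro h
    rw [← Real.rpow_natCast, ← Real.rpow_natCast, Real.rpow_def_of_pos (hqR0 _),
      Real.rpow_def_of_pos (hqR0 _), Real.exp_le_exp, mul_comm, mul_comm (Real.log _)]
    exact hR1 h
  exact ⟨r, hr0, hR1, hR2, fun h => hri₀ ▸ hR3 h, hR4, hR5⟩

/-- **The exponent is negative** (the final comparison, Schmidt §11 / B–G Step V, for the
parameters of `false_of_class`): with `ε₁ ≤ min(ε,1)/40`, `w₀ ≥ (m/2)(1-2ε₁) ≥ 0`,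
`(1+ε)Λ ≥ 1 + ε/2`, `ε L > 8(C₁ + 1)`, `C₁ ≥ 0`, the exponent
`m r₁ C₁ − W w₀ + m(1+ε₁)W − (1+ε) Λ W w₀` (`W = r₁ L`) is negative. [folklore] -/
theorem exponent_neg {m r₁ : ℕ} (hm : 2 ≤ m) (hr₁ : 0 < r₁) {ε ε₁ C₁ L Λ w₀ : ℝ} (hε : 0 < ε)
    (hε₁0 : 0 < ε₁) (hε₁ε : ε₁ ≤ ε / 40) (hε₁1 : ε₁ ≤ 1 / 40) (hC₁ : 0 ≤ C₁)
    (hL : 8 * (C₁ + 1) < ε * L) (hL0 : 0 < L) (hΛ : 1 + ε / 2 ≤ (1 + ε) * Λ)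
    (hw₀low : (m : ℝ) / 2 * (1 - 2 * ε₁) ≤ w₀) (hw₀0 : 0 ≤ w₀) :
    ((m * r₁ : ℕ) : ℝ) * C₁ - 1 * (r₁ * L) * w₀ + m * ((1 + ε₁) * (r₁ * L)) -
      (1 + ε) * Λ * (r₁ * L) * w₀ < 0 := by
  have hmR : (2 : ℝ) ≤ m := by exact_mod_cast hm
  have hr₁R : (0 : ℝ) < r₁ := by exact_mod_cast hr₁
  set W : ℝ := r₁ * L with hW
  have hW0 : 0 < W := mul_pos hr₁R hL0
  have hmr : ((m * r₁ : ℕ) : ℝ) = (m : ℝ) * r₁ := by push_cast; ring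
  rw [hmr]
  -- `W w₀ (1 + (1+ε)Λ) ≥ W (m/2)(1-2ε₁) (2 + ε/2)`
  have hΛ' : 2 + ε / 2 ≤ 1 + (1 + ε) * Λ := by linarith
  have hkey : W * ((m : ℝ) / 2 * (1 - 2 * ε₁)) * (2 + ε / 2) ≤ W * w₀ * (1 + (1 + ε) * Λ) := by
    have h1 : ((m : ℝ) / 2 * (1 - 2 * ε₁)) * (2 + ε / 2) ≤ w₀ * (1 + (1 + ε) * Λ) :=
      mul_le_mul hw₀low hΛ' (by positivity) hw₀0
    have := mul_le_mul_of_nonneg_left h1 hW0.le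
    linarith [this]
  -- `3 ε₁ + ε₁ ε / 2 - ε/4 ≤ -13 ε / 80`
  have hbr : 3 * ε₁ + ε₁ * ε / 2 - ε / 4 ≤ -(13 * ε / 80) := by
    have : ε₁ * ε ≤ ε / 40 := by nlinarith
    linarith
  have hmW : 0 < (m : ℝ) * W := by positivity
  have hE1 : (m : ℝ) * r₁ * C₁ - 1 * W * w₀ + m * ((1 + ε₁) * W) - (1 + ε) * Λ * W * w₀ ≤
      (m : ℝ) * r₁ * C₁ + m * W * (3 * ε₁ + ε₁ * ε / 2 - ε / 4) := by
    nlinarith [hkey]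
  have hE2 : (m : ℝ) * W * (3 * ε₁ + ε₁ * ε / 2 - ε / 4) ≤ -((m : ℝ) * W * (13 * ε / 80)) := by
    have := mul_le_mul_of_nonneg_left hbr hmW.le
    linarith
  have hmr0 : 0 < (m : ℝ) * r₁ := by positivity
  have h3 : (m : ℝ) * W * (13 * ε / 80) = (m : ℝ) * r₁ * ((13 / 80) * (ε * L)) := by
    rw [hW]; ring
  have h4 : (m : ℝ) * r₁ * C₁ < (m : ℝ) * r₁ * ((13 / 80) * (ε * L)) := by
    apply mul_lt_mul_of_pos_left _ hmr0
    nlinarith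
  linarith

set_option maxHeartbeats 1000000 in
-- a long §11-type assembly; the heartbeat budget is for the single `theorem` command
/-- **No approximation class is infinite** (the core of Ridout's theorem over `ℚ`; Schmidt's §11
run with the several-targets Index Theorem, Roth's Lemma 10A, and the `S ∪ {∞}` estimates of
Bombieri–Gubler 6.2.9 / §6.4 — see the module docstring for the statement and the proof).
[cite: BombieriGubler2006, §6.4 (proof of Thm. 6.4.1) with 6.2.5–6.2.6; Schmidt1980, Ch. V §11] -/
theorem false_of_class (S : Finset Nat.Primes) (Q : Nat.Primes → ℤ[X])
    (hQm : ∀ p ∈ S, (Q p).Monic) (hQd : ∀ p ∈ S, 1 ≤ (Q p).natDegree)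
    (θ : ∀ p : Nat.Primes, @PadicAlgCl (p : ℕ) ⟨p.2⟩)
    (hθ : ∀ p ∈ S, Polynomial.aeval (θ p) (Q p) = 0)
    (c₀ : ℕ) (hc₀ : 1 ≤ c₀) {ε : ℝ} (hε : 0 < ε)
    (lam : Nat.Primes → ℝ) (hlam0 : ∀ p, 0 ≤ lam p)
    (hlam : 1 + ε / 2 ≤ (1 + ε) * ∑ p ∈ S, lam p)
    (hsupply : ∀ N : ℕ, ∃ ρ : ℚ, N < ρ.den ∧ (|ρ.num| ≤ c₀ ∧
      ∀ p ∈ S, min 1 ‖(ρ : @PadicAlgCl (p : ℕ) ⟨p.2⟩) - θ p‖ ≤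
        (ρ.den : ℝ) ^ (-((1 + ε) * lam p)))) :
    False := by
  classical
  have _inst (p : Nat.Primes) : Fact (p : ℕ).Prime := ⟨p.2⟩
  /- (ii) `ε₁` -/
  set ε₁ : ℝ := min ε 1 / 40 with hε₁_def
  have hmin0 : 0 < min ε 1 := lt_min hε one_pos
  have hε₁0 : 0 < ε₁ := by positivity
  have hε₁ε : ε₁ ≤ ε / 40 := by
    rw [hε₁_def]; exact div_le_div_of_nonneg_right (min_le_left _ _) (by norm_num)
  have hε₁1 : ε₁ ≤ 1 / 40 := by
    rw [hε₁_def]; linarith [min_le_right ε 1]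
  have hε₁12 : ε₁ < 1 / 12 := by linarith
  have hε₁le1 : ε₁ ≤ 1 := by linarith
  /- the targets: `Q_p` for `p ∈ S` and `X` (root `0`) for the place `∞` -/
  set Qf : Option ↥S → ℤ[X] := fun o => o.elim Polynomial.X fun p => Q p.1 with hQf
  have hQfm : ∀ o, (Qf o).Monic := by
    rintro (_ | p)
    · exact Polynomial.monic_X
    · exact hQm p.1 p.2
  have hQfd : ∀ o, 1 ≤ (Qf o).natDegree := by
    rintro (_ | p)
    · simp [hQf]
    · exact hQd p.1 p.2
  obtain ⟨B₀, hB₀1, h7A⟩ := Ridout.indexTheorem Qf hQfm hQfd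
  set Dlog : ℝ := Real.log (4 * ∑ o, (Qf o).natDegree) with hDlog
  /- (iii) `m` and `ω` -/
  set m : ℕ := ⌈16 / ε₁ ^ 2 * Dlog⌉₊ + 2 with hm_def
  have hm2 : 2 ≤ m := Nat.le_add_left _ _
  have hm0 : 0 < m := lt_of_lt_of_le two_pos hm2
  have hmR2 : (2 : ℝ) ≤ m := by exact_mod_cast hm2
  have hmlog : 16 / ε₁ ^ 2 * Dlog < m := by
    rw [hm_def]; push_cast
    have := Nat.le_ceil (16 / ε₁ ^ 2 * Dlog); linarith
  set ω : ℝ := omega m ε₁ with hω_def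
  have hω0 : 0 < ω := omega_pos hε₁0
  have hω1 : ω < 1 := (omega_le_half' hm2 hε₁0.le (by linarith)).trans_lt (by linarith)
  have h2ω : 1 < 2 / ω := by rw [lt_div_iff₀ hω0]; linarith
  /- the constants `B`, `C₁ = log(4 B c₀)` -/
  set B : ℝ := (B₀ : ℝ) with hB_def
  have hB1 : 1 ≤ B := by rw [hB_def]; exact_mod_cast hB₀1
  have hc₀R : (1 : ℝ) ≤ c₀ := by exact_mod_cast hc₀
  set C₁ : ℝ := Real.log (4 * B * c₀) with hC₁_def
  have hC₁0 : 0 ≤ C₁ := Real.log_nonneg (by nlinarith)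
  /- (iv)-(v) the chain `ρ_h = p_h/q_h`, `q_h > T` -/
  set T : ℝ := max (max ((B ^ m) ^ ω⁻¹) (Real.exp (8 * (C₁ + 1) / ε)))
    (max (((2 : ℝ) ^ (3 * m)) ^ ω⁻¹) 2) with hT_def
  set N₀ : ℕ := ⌈T⌉₊ with hN₀_def
  obtain ⟨g, hg_prop, hg_N₀, hg_grow, hg_mono⟩ := exists_chain hsupply N₀ (2 / ω)
  set pn : Fin m → ℤ := fun h => (g h).num with hpn_def
  set q : Fin m → ℕ := fun h => (g h).den with hq_def
  have hq0 : ∀ h, 0 < q h := fun h => (g h).den_pos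
  have hqR0 : ∀ h, (0 : ℝ) < q h := fun h => by exact_mod_cast hq0 h
  have hcop : ∀ h, Nat.Coprime (pn h).natAbs (q h) := fun h => (g h).reduced
  have hnum : ∀ h, |(pn h : ℝ)| ≤ c₀ := fun h => by
    have := (hg_prop h).1; exact_mod_cast this
  have hclass : ∀ h : Fin m, ∀ p ∈ S, min 1 ‖((g h : ℚ) : PadicAlgCl (p : ℕ)) - θ p‖ ≤
      (q h : ℝ) ^ (-((1 + ε) * lam p)) := fun h p hp => (hg_prop h).2 p hp
  have hqT : ∀ h : Fin m, T < q h := fun h =>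
    calc T ≤ N₀ := Nat.le_ceil T
      _ < q h := by exact_mod_cast hg_N₀ h
  have hq2 : ∀ h, (2 : ℝ) < q h := fun h =>
    lt_of_le_of_lt ((le_max_right _ _).trans (le_max_right _ _)) (hqT h)
  have key : ∀ {a t x : ℝ}, 0 ≤ a → 0 < t → a ^ t⁻¹ < x → a < x ^ t := by
    intro a t x ha ht h
    calc a = (a ^ t⁻¹) ^ t := (Real.rpow_inv_rpow ha ht.ne').symm
      _ < x ^ t := Real.rpow_lt_rpow (Real.rpow_nonneg ha _) h ht
  have hqB : ∀ h, B ^ m < (q h : ℝ) ^ ω := fun h =>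
    key (by positivity) hω0 (lt_of_le_of_lt ((le_max_left _ _).trans (le_max_left _ _)) (hqT h))
  have hqexp : ∀ h, Real.exp (8 * (C₁ + 1) / ε) < (q h : ℝ) := fun h =>
    lt_of_le_of_lt ((le_max_right _ _).trans (le_max_left _ _)) (hqT h)
  have hq3m : ∀ h, (2 : ℝ) ^ (3 * m) ≤ (q h : ℝ) ^ ω := fun h =>
    (key (by positivity) hω0
      (lt_of_le_of_lt ((le_max_left _ _).trans (le_max_right _ _)) (hqT h))).le
  -- monotonicity and growth of the denominators
  have hgmono : StrictMono fun k => (g k).den := strictMono_nat_of_lt_succ hg_mono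
  have hqlt : ∀ h h' : Fin m, h < h' → q h < q h' := fun h h' hh => hgmono hh
  have hqle : ∀ h h' : Fin m, h ≤ h' → q h ≤ q h' := fun h h' hh => hgmono.monotone hh
  have hLgrow : ∀ h h' : Fin m, (h : ℕ) + 1 = h' →
      (2 / ω) * Real.log (q h) ≤ Real.log (q h') := by
    intro h h' hh
    have h0 : ((g h).den : ℝ) ^ (2 / ω) ≤ (g ((h : ℕ) + 1)).den := hg_grow h
    rw [hh] at h0
    have h1 := Real.log_le_log (Real.rpow_pos_of_pos (hqR0 h) _) h0
    rwa [Real.log_rpow (hqR0 h)] at h1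
  have hL0 : ∀ h, 0 < Real.log (q h) := fun h => Real.log_pos (by linarith [hq2 h])
  /- (vi)-(vii) the degrees `r_h` -/
  set i₀ : Fin m := ⟨0, hm0⟩ with hi₀_def
  obtain ⟨r, hr0, hR1, hR2, hR3, hR4, hR5⟩ :=
    exists_degrees hm0 q hq2 hqle hqlt hω0 hLgrow hε₁0 hε₁le1
  set r₁ : ℕ := r i₀ with hr₁_def
  have hr₁pos : 0 < r₁ := hr0 i₀
  have hsum : ∑ h, r h ≤ m * r₁ :=
    calc ∑ h, r h ≤ ∑ _h : Fin m, r₁ := Finset.sum_le_sum fun h _ => hR3 h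
      _ = m * r₁ := by simp
  have hsumR : ((∑ h, r h : ℕ) : ℝ) ≤ m * r₁ := by exact_mod_cast hsum
  /- the auxiliary polynomial of the several-targets Index Theorem -/
  set rN : ℕ → ℕ := fun h => if hh : h < m then r ⟨h, hh⟩ else 1 with hrN_def
  have hrN : ∀ h : Fin m, rN h = r h := fun h => by simp [hrN_def, h.isLt]
  have hrNfun : (fun h : Fin m => rN h) = r := funext hrN
  have hrN0 : ∀ h, h < m → 0 < rN h := fun h hh => by
    simp only [hrN_def, dif_pos hh]; exact hr0 _
  obtain ⟨P, hP0, hPdeg', hPind', hPht'⟩ := h7A ε₁ hε₁0 m hmlog rN hrN0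
  have hPdeg : ∀ h, P.degreeOf h ≤ r h := fun h => hrN h ▸ hPdeg' h
  have hPind0 : IndexGe P (fun _ : Fin m => (0 : ℝ)) r (m / 2 * (1 - ε₁)) := by
    have := hPind' none ℝ 0 (by simp [hQf])
    rwa [hrNfun] at this
  have hPindp : ∀ p (hp : p ∈ S),
      IndexGe P (fun _ : Fin m => θ p) r (m / 2 * (1 - ε₁)) := by
    intro p hp
    have := hPind' (some ⟨p, hp⟩) (PadicAlgCl (p : ℕ)) (θ p) (by
      show Polynomial.aeval (θ p) (Q p) = 0
      convert hθ p hp)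
    rwa [hrNfun] at this
  have hPhtB : (height P : ℝ) ≤ B ^ (∑ h, r h) := by
    have h1 : ((height P : ℕ) : ℝ) ≤ ((B₀ ^ (∑ h : Fin m, rN h) : ℕ) : ℝ) := by
      exact_mod_cast hPht'
    rw [hB_def]
    simpa [hrN] using h1
  /- Roth's lemma: some `P_J(ρ) ≠ 0` with `wt J ≤ ε₁` -/
  have hPhtω : (height P : ℝ) ≤ (q i₀ : ℝ) ^ (omega m ε₁ * (r i₀ : ℕ)) := by
    have h2 : B ^ (∑ h, r h) ≤ B ^ (m * r₁) := pow_le_pow_right₀ hB1 hsum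
    have h4 : (B ^ m) ^ r₁ < ((q i₀ : ℝ) ^ ω) ^ r₁ :=
      pow_lt_pow_left₀ (hqB i₀) (by positivity) hr₁pos.ne'
    have h5 : ((q i₀ : ℝ) ^ ω) ^ r₁ = (q i₀ : ℝ) ^ (ω * (r i₀ : ℕ)) := by
      rw [hr₁_def, Real.rpow_mul (hqR0 i₀).le, Real.rpow_natCast]
    rw [← h5, ← pow_mul] at *
    linarith
  obtain ⟨J, hJwt, hJne⟩ := rothLemma m hm0 ε₁ hε₁0 hε₁12 r hr0 hR4 pn q hq0 hcop hR5 hq3m P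
    hP0 hPdeg hPhtω
  /- the polynomial `T = P_J`: degrees, height, index at the targets -/
  set PJ : MvPolynomial (Fin m) ℤ := hasseD J P with hPJ_def
  have hPJdeg : ∀ h, PJ.degreeOf h ≤ r h := fun h =>
    (degreeOf_hasseD_le h J P).trans ((Nat.sub_le _ _).trans (hPdeg h))
  have hPJht : (height PJ : ℝ) ≤ 2 ^ (∑ h, r h) * height P := by
    exact_mod_cast height_hasseD_le J P r hPdeg
  set w₀ : ℝ := m / 2 * (1 - ε₁) - ε₁ with hw₀_def
  have hw₀' : m / 2 * (1 - ε₁) - wt r J ≥ w₀ := by rw [hw₀_def]; linarith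
  have hw₀low : (m : ℝ) / 2 * (1 - 2 * ε₁) ≤ w₀ := by
    have h1 : w₀ - (m : ℝ) / 2 * (1 - 2 * ε₁) = ε₁ * ((m : ℝ) / 2 - 1) := by rw [hw₀_def]; ring
    have h2 : 0 ≤ ε₁ * ((m : ℝ) / 2 - 1) := mul_nonneg hε₁0.le (by linarith)
    linarith
  have hw₀0 : 0 ≤ w₀ :=
    le_trans (mul_nonneg (by positivity) (by linarith)) hw₀low
  have hPJind0 : IndexGe PJ (fun _ : Fin m => (0 : ℝ)) r w₀ := (hPind0.hasseD J).mono hw₀'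
  have hPJindp : ∀ p (hp : p ∈ S), IndexGe PJ (fun _ : Fin m => θ p) r w₀ := fun p hp =>
    ((hPindp p hp).hasseD J).mono hw₀'
  /- the non-zero integer `N = q₁^{r₁}⋯q_m^{r_m} P_J(ρ)` -/
  set L : ℝ := Real.log (q i₀) with hL_def
  set W : ℝ := (r₁ : ℝ) * L with hW_def
  have hW0 : 0 < W := mul_pos (by exact_mod_cast hr₁pos) (hL0 i₀)
  have hR1W : ∀ h, W ≤ r h * Real.log (q h) := fun h => by rw [hW_def, hr₁_def]; exact hR1 h
  set ρQ : Fin m → ℚ := fun h => (pn h : ℚ) / q h with hρQ_def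
  have hρQg : ∀ h, ρQ h = g h := fun h => Rat.num_div_den (g h)
  obtain ⟨N, hN⟩ := exists_int_aeval_eq PJ r hPJdeg pn q hq0
  have hfunR : (fun h => ((ρQ h : ℚ) : ℝ)) = fun h => (pn h : ℝ) / q h := by
    funext h; rw [hρQ_def]; push_cast; rfl
  have hvalR : aeval (fun h => (pn h : ℝ) / q h) PJ = ((aeval ρQ PJ : ℚ) : ℝ) := by
    rw [← hfunR, aeval_ratCast]
  have hNR : ((aeval ρQ PJ : ℚ) : ℝ) * ∏ h, (q h : ℝ) ^ (r h) = N := by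
    have := congrArg (fun x : ℚ => (x : ℝ)) hN
    push_cast at this
    exact this
  have hprodq0 : 0 < ∏ h, (q h : ℝ) ^ (r h) := prod_pos fun h _ => pow_pos (hqR0 h) _
  have hN0 : N ≠ 0 := by
    intro hN0
    rw [hN0, Int.cast_zero, mul_eq_zero] at hNR
    rcases hNR with h | h
    · exact hJne (by rw [hvalR, h])
    · exact hprodq0.ne' h
  /- the product formula: `1 ≤ |T| Π q_h^{r_h} Π_p min(1, |T|_p)` -/
  have hNp : ∀ p ∈ S, ‖(N : PadicAlgCl (p : ℕ))‖ ≤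
      min 1 ‖aeval (fun h => ((ρQ h : ℚ) : PadicAlgCl (p : ℕ))) PJ‖ := by
    intro p hp
    refine le_min (IsUltrametricDist.norm_intCast_le_one _ N) ?_
    have h1 : ((aeval ρQ PJ : ℚ) : PadicAlgCl (p : ℕ)) *
        ∏ h, ((q h : ℕ) : PadicAlgCl (p : ℕ)) ^ (r h) = (N : PadicAlgCl (p : ℕ)) := by
      have := congrArg (fun x : ℚ => (x : PadicAlgCl (p : ℕ))) hN
      push_cast at this
      exact this
    rw [← h1, ← aeval_ratCast, norm_mul, norm_prod]
    refine mul_le_of_le_one_right (norm_nonneg _) (prod_le_one (fun _ _ => by positivity) ?_)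
    intro h _
    rw [norm_pow]
    have hqn := IsUltrametricDist.norm_natCast_le_one (PadicAlgCl (p : ℕ)) (q h)
    exact pow_le_one₀ (norm_nonneg _) hqn
  have hlower : 1 ≤ |aeval (fun h => (pn h : ℝ) / q h) PJ| * (∏ h, (q h : ℝ) ^ (r h)) *
      ∏ p ∈ S, min 1 ‖aeval (fun h => ((ρQ h : ℚ) : PadicAlgCl (p : ℕ))) PJ‖ := by
    have h1 := one_le_abs_mul_prod_norm S hN0
    have h2 : |(N : ℝ)| = |aeval (fun h => (pn h : ℝ) / q h) PJ| * ∏ h, (q h : ℝ) ^ (r h) := by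
      rw [← hNR, ← hvalR, abs_mul, abs_of_pos hprodq0]
    rw [h2] at h1
    refine h1.trans (mul_le_mul_of_nonneg_left ?_ (by positivity))
    exact prod_le_prod (fun p _ => norm_nonneg _) hNp
  /- the upper bounds -/
  -- weights: `Π (q_h^{-s})^{i_h} ≤ e^{-s W wt(i)} ≤ e^{-s W w₀}` beyond the index
  have hmono : ∀ (s : ℝ), 0 ≤ s → ∀ i : Fin m →₀ ℕ, w₀ ≤ wt r i →
      ∏ h, ((q h : ℝ) ^ (-s)) ^ (i h) ≤ Real.exp (-(s * W * w₀)) := by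
    intro s hs i hi
    refine (prod_rpow_le_exp r hr0 (fun h => (q h : ℝ)) hqR0 W hR1W hs i).trans ?_
    rw [Real.exp_le_exp]
    have : s * W * w₀ ≤ s * W * wt r i := mul_le_mul_of_nonneg_left hi (by positivity)
    linarith
  -- (∞): `|T| ≤ Π(r_h+1) |P_J| c₀^{Σr} e^{-W w₀}`
  have hU0 : |aeval (fun h => (pn h : ℝ) / q h) PJ| ≤
      (∏ h, ((r h : ℝ) + 1)) * height PJ *
        ((c₀ : ℝ) ^ (∑ h, r h) * Real.exp (-(1 * W * w₀))) := by
    refine abs_aeval_le_of_indexGe_zero PJ r hPJdeg w₀ hPJind0 _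
      (fun h => (c₀ : ℝ) * (q h : ℝ) ^ (-(1 : ℝ))) (fun h => ?_) _ (by positivity)
      (fun i hir hwi => ?_)
    · rw [abs_div, Real.rpow_neg_one, ← div_eq_mul_inv, Nat.abs_cast]
      exact div_le_div_of_nonneg_right (hnum h) (hqR0 h).le
    · simp_rw [mul_pow]
      rw [prod_mul_distrib, prod_pow_eq_pow_sum]
      refine mul_le_mul (pow_le_pow_right₀ hc₀R (sum_le_sum fun h _ => hir h))
        (hmono 1 zero_le_one i hwi) (prod_nonneg fun h _ => by positivity) (by positivity)
  -- (p): `min(1, |T|_p) ≤ e^{-(1+ε) λ_p W w₀}`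
  have hUp : ∀ p ∈ S, min 1 ‖aeval (fun h => ((ρQ h : ℚ) : PadicAlgCl (p : ℕ))) PJ‖ ≤
      Real.exp (-((1 + ε) * lam p * W * w₀)) := by
    intro p hp
    rcases (hlam0 p).eq_or_lt with h0 | hpos
    · rw [← h0]
      simp only [mul_zero, zero_mul, neg_zero, Real.exp_zero]
      exact min_le_left _ _
    · have hs0 : 0 ≤ (1 + ε) * lam p := by positivity
      have hδ : ∀ h, ‖((ρQ h : ℚ) : PadicAlgCl (p : ℕ)) - θ p‖ ≤
          (q h : ℝ) ^ (-((1 + ε) * lam p)) := by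
        intro h
        have h1 := hclass h p hp
        rw [hρQg h]
        have hlt1 : (q h : ℝ) ^ (-((1 + ε) * lam p)) < 1 :=
          Real.rpow_lt_one_of_one_lt_of_neg (by linarith [hq2 h]) (by nlinarith)
        rcases min_le_iff.mp h1 with h2 | h2
        · exact absurd (h2.trans_lt hlt1) (lt_irrefl _)
        · exact h2
      refine le_trans (min_le_right _ _) ?_
      exact norm_aeval_le_of_indexGe PJ r hPJdeg (θ p)
        (norm_root_le_one (Q p) (hQm p hp) (θ p) (hθ p hp)) w₀ (hPJindp p hp) _ _ hδ _
        (by positivity) (fun i _ hwi => hmono _ hs0 i hwi)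
  -- (q): `Π q_h^{r_h} ≤ e^{m (1+ε₁) W}`
  have hUq : ∏ h, (q h : ℝ) ^ (r h) ≤ Real.exp (m * ((1 + ε₁) * W)) := by
    have h1 : ∏ h, (q h : ℝ) ^ (r h) = Real.exp (∑ h, (r h : ℝ) * Real.log (q h)) := by
      rw [Real.exp_sum]
      refine prod_congr rfl fun h _ => ?_
      rw [← Real.rpow_natCast, Real.rpow_def_of_pos (hqR0 h), mul_comm]
    rw [h1, Real.exp_le_exp]
    calc ∑ h, (r h : ℝ) * Real.log (q h) ≤ ∑ _h : Fin m, (1 + ε₁) * W :=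
          sum_le_sum fun h _ => hR2 h
      _ = m * ((1 + ε₁) * W) := by simp
  /- combining: `1 ≤ (4 B c₀)^{m r₁} e^{E'}` -/
  set Λ : ℝ := ∑ p ∈ S, lam p with hΛ_def
  have hprodp : ∏ p ∈ S, min 1 ‖aeval (fun h => ((ρQ h : ℚ) : PadicAlgCl (p : ℕ))) PJ‖ ≤
      Real.exp (-((1 + ε) * Λ * W * w₀)) := by
    have h1 : Real.exp (-((1 + ε) * Λ * W * w₀)) =
        ∏ p ∈ S, Real.exp (-((1 + ε) * lam p * W * w₀)) := by
      rw [← Real.exp_sum, hΛ_def]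
      congr 1
      rw [mul_sum, sum_mul, sum_mul, ← sum_neg_distrib]
    rw [h1]
    exact prod_le_prod (fun p _ => le_min zero_le_one (norm_nonneg _)) hUp
  -- sizes of the prefactors
  have hSr : ((∑ h, r h : ℕ) : ℝ) ≤ m * r₁ := hsumR
  have h2pow : (2 : ℝ) ^ (∑ h, r h) ≤ 2 ^ (m * r₁) := pow_le_pow_right₀ (by norm_num) hsum
  have hcard : (∏ h, ((r h : ℝ) + 1)) ≤ 2 ^ (m * r₁) := by
    have h1 : ((∏ h, (r h + 1) : ℕ) : ℝ) ≤ ((2 ^ (∑ h, r h) : ℕ) : ℝ) := by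
      exact_mod_cast prod_succ_le_two_pow_sum r
    push_cast at h1
    exact h1.trans h2pow
  have hhtPJ : (height PJ : ℝ) ≤ 2 ^ (m * r₁) * B ^ (m * r₁) := by
    refine hPJht.trans ?_
    exact mul_le_mul h2pow (hPhtB.trans (pow_le_pow_right₀ hB1 hsum)) (by positivity)
      (by positivity)
  have hc₀pow : (c₀ : ℝ) ^ (∑ h, r h) ≤ (c₀ : ℝ) ^ (m * r₁) := pow_le_pow_right₀ hc₀R hsum
  have hX : (∏ h, ((r h : ℝ) + 1)) * height PJ * ((c₀ : ℝ) ^ (∑ h, r h)) ≤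
      (4 * B * c₀) ^ (m * r₁) := by
    calc (∏ h, ((r h : ℝ) + 1)) * height PJ * ((c₀ : ℝ) ^ (∑ h, r h))
        ≤ 2 ^ (m * r₁) * (2 ^ (m * r₁) * B ^ (m * r₁)) * (c₀ : ℝ) ^ (m * r₁) := by
          gcongr
      _ = (4 * B * c₀) ^ (m * r₁) := by
          rw [mul_pow, mul_pow, show (4 : ℝ) = 2 * 2 by norm_num, mul_pow]; ring
  have hX' : (4 * B * c₀) ^ (m * r₁) = Real.exp ((m * r₁ : ℕ) * C₁) := by
    rw [Real.exp_nat_mul, hC₁_def, Real.exp_log (by positivity)]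
  -- the main inequality `1 ≤ exp(E)`
  set E : ℝ := (m * r₁ : ℕ) * C₁ - 1 * W * w₀ + m * ((1 + ε₁) * W) - (1 + ε) * Λ * W * w₀
    with hE_def
  have hmain : (1 : ℝ) ≤ Real.exp E := by
    have hA0 : 0 ≤ |aeval (fun h => (pn h : ℝ) / q h) PJ| := abs_nonneg _
    calc (1 : ℝ) ≤ |aeval (fun h => (pn h : ℝ) / q h) PJ| * (∏ h, (q h : ℝ) ^ (r h)) *
          ∏ p ∈ S, min 1 ‖aeval (fun h => ((ρQ h : ℚ) : PadicAlgCl (p : ℕ))) PJ‖ := hlower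
      _ ≤ ((∏ h, ((r h : ℝ) + 1)) * height PJ *
            ((c₀ : ℝ) ^ (∑ h, r h) * Real.exp (-(1 * W * w₀)))) *
          Real.exp (m * ((1 + ε₁) * W)) * Real.exp (-((1 + ε) * Λ * W * w₀)) := by
          refine mul_le_mul (mul_le_mul hU0 hUq hprodq0.le (by positivity)) hprodp
            (prod_nonneg fun p _ => le_min zero_le_one (norm_nonneg _)) (by positivity)
      _ = ((∏ h, ((r h : ℝ) + 1)) * height PJ * ((c₀ : ℝ) ^ (∑ h, r h))) *
          (Real.exp (-(1 * W * w₀)) * Real.exp (m * ((1 + ε₁) * W)) *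
            Real.exp (-((1 + ε) * Λ * W * w₀))) := by ring
      _ ≤ (4 * B * c₀) ^ (m * r₁) *
          (Real.exp (-(1 * W * w₀)) * Real.exp (m * ((1 + ε₁) * W)) *
            Real.exp (-((1 + ε) * Λ * W * w₀))) := by
          gcongr
      _ = Real.exp E := by
          rw [hX', hE_def, ← Real.exp_add, ← Real.exp_add, ← Real.exp_add]
          ring_nf
  /- the exponent is negative: contradiction -/
  have hL : 8 * (C₁ + 1) < ε * L := by
    have h1 : 8 * (C₁ + 1) / ε < Real.log (q i₀) :=
      (Real.lt_log_iff_exp_lt (hqR0 i₀)).mpr (hqexp i₀)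
    rw [div_lt_iff₀ hε] at h1
    calc 8 * (C₁ + 1) < Real.log (q i₀) * ε := h1
      _ = ε * L := by rw [hL_def, mul_comm]
  have hE : E < 0 :=
    exponent_neg hm2 hr₁pos hε hε₁0 hε₁ε hε₁1 hC₁0 hL (hL0 i₀) hlam hw₀low hw₀0
  have hlt : Real.exp E < 1 := Real.exp_lt_one_iff.mpr hE
  linarith

end Ridout

end Literature.NumberTheory.DiophantineApproximation

end
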